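import Mathlib.ModelTheory.Satisfiability
import Mathlib.ModelTheory.Complexity
import Mathlib.Order.Zorn
import HarnessLib

/-!
# Herbrand-saturated models of universal theories (Avigad 2002)

Trunk: generic model theory (`Literature/ModelTheory`), in support of the conservation results
of bounded arithmetic (`Literature/Computability/Complexity/BoundedArithmetic.lean`: Buss's
theorem that `S₂ⁱ⁺¹` is `∀Σᵇᵢ₊₁`-conservative over `T₂ⁱ`, whose model-theoretic proofs —
Zambella 1996, Krajíček 1995 §7.6, Avigad 2002 §4 — rest on the construction formalised here),
following

* J. Avigad, *Saturated models of universal theories*, Ann. Pure Appl. Logic 118 (2002)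
  219–234, §3 (Definition 3.1, Theorems 3.2, 3.3, 3.4).

Avigad's notion of an *Herbrand-saturated* structure is the model-theoretic analogue of
Herbrand analysis / Buss's witnessing method: every universal theory has an Herbrand-saturated
model (Thm. 3.2), `∀∃`-facts true in such a model are witnessed by finitely many terms (Thm. 3.3),
and consequently, if every Herbrand-saturated model of a universal theory `T₂` is a model of
`T₁`, then `T₁` is `∀∃`-conservative over `T₂` (Thm. 3.4).  Everything in this file is proved
(no named facts), inside Mathlib's `FirstOrder` library, with provability read as Mathlib's
semantic consequence `⊨ᵇ` (equivalent by completeness).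

## Main definitions and results

* `Literature.ModelTheory.PreservesUniversal L f`: the map `f : M → N` preserves every universal
  formula with parameters from `M` (i.e. `N`, via `f`, is a model of the universal diagram of
  `M`; equivalently `f` is a `Σ₁`-elementary embedding); such a map is an embedding
  (`PreservesUniversal.toEmbedding`), and `preservesUniversal_iff` gives the prenex form.
* `Literature.ModelTheory.IsHerbrandSaturated L M` (Avigad 2002, Def. 3.1): every principal universal
  type `∀ ȳ φ(x̄, ȳ, ā)` (`φ` quantifier-free, parameters `ā` from `M`) which is consistent
  with the universal diagram of `M` is realized in `M`.
* `exists_isHerbrandSaturated_of_realize` (Avigad 2002, Thm. 3.2, in the slightly more general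
  form used in the proof of Thm. 3.4: a universal theory together with a satisfiable set of
  universal sentences about extra constants `D` has an Herbrand-saturated model);
  `exists_isHerbrandSaturated` (Thm. 3.2 as printed); `exists_preservesUniversal_isHerbrandSaturated`
  (the remark after Thm. 3.2: every structure has a `Σ₁`-elementary extension which is Herbrand
  saturated).
* `IsHerbrandSaturated.exists_finset_term` (Avigad 2002, Thm. 3.3, in the "in particular" form:
  a `∀∃` fact true in an Herbrand-saturated structure is witnessed by a finite set of tuples of
  terms with parameters).
* `modelsBoundedFormula_exs_of_isHerbrandSaturated` (Avigad 2002, Thm. 3.4): the recipe for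
  `∀∃`-conservation theorems.

## Design choices

* Parameters from `M` are handled as *variables* indexed by `M` (a formula with parameters is an
  `L.BoundedFormula (M ⊕ Fin k) m` realized at `Sum.elim id x̄`), which is equivalent to
  Mathlib's `L[[M]]` formalism (`BoundedFormula.constantsVarsEquiv`) but avoids iterated
  constant extensions.  Accordingly "consistent with the universal diagram of `M`" is phrased
  semantically: realized in some structure `K` into which `M` maps by a map preserving all
  universal formulas with parameters (`PreservesUniversal`).  The structure `K` is taken in the
  universe `max u v w` (that of Mathlib's `Theory.ModelType` for `L[[M]]`-theories, `M : Type w`);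
  by the Löwenheim–Skolem theorem built into `Theory.IsSatisfiable` this is no restriction.
* The proof of Thm. 3.2 follows Avigad's, with the countable enumeration of formulas replaced by
  an `ω`-tower of constant types `Cum n` (stage `n + 1` adds fresh witnesses for *all* `∃∀`
  sentences over stage `n`) and, at each stage, a maximal consistent family of Henkin-type axioms
  chosen by Zorn's lemma; the model is the term submodel of a model of the union (compactness).
  No countability assumption on `L` is needed.
* Thm. 3.3 is proved, as in the paper, by Herbrand's theorem, itself argued model-theoretically
  (compactness applied to the universal diagram of `M` plus the negated term instances, then
  the term submodel); it assumes `M` nonempty (Avigad assumes every language has a constant).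
* Names live in `Literature.ModelTheory`, except the small syntactic closure lemmas
  `BoundedFormula.IsQF.subst/restrictFreeVar/toFormula/mapTermRel_id`,
  `BoundedFormula.IsUniversal.relabel/formulaRelabel/alls`, `BoundedFormula.IsQF.isUniversal_alls`,
  which are deliberate dot-notation extensions of Mathlib's `FirstOrder.Language.BoundedFormula`
  namespace (no Mathlib declaration of these names exists; verified by grep).

## References

* J. Avigad, *Saturated models of universal theories*, Ann. Pure Appl. Logic 118 (2002),
  no. 3, 219–234, doi:10.1016/s0168-0072(02)00030-1: §2 (universal diagram, Herbrand's theorem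
  2.1), §3 (Def. 3.1, Thms. 3.2–3.4).
* J. Krajíček, *Bounded Arithmetic, Propositional Logic and Complexity Theory*, CUP 1995, §7.6
  (the same construction for bounded arithmetic, after Zambella and Visser).
-/

universe u v w w' w₁

open FirstOrder FirstOrder.Language FirstOrder.Language.BoundedFormula
open Set

namespace Literature.ModelTheory.UniversalTheories

variable {L : Language.{u, v}}

/-! ## Syntactic lemmas: quantifier-free and universal formulas are stable under relabellings -/

section Syntax

variable {α β : Type*} {n : ℕ}

/-- Quantifier-free formulas are preserved by `mapTermRel` when bound variables are untouched
(the map only rewrites terms and relation symbols). [folklore] -/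
theorem _root_.FirstOrder.Language.BoundedFormula.IsQF.mapTermRel_id {L' : Language}
    {φ : L.BoundedFormula α n} (h : φ.IsQF)
    (ft : ∀ n, L.Term (α ⊕ Fin n) → L'.Term (β ⊕ Fin n))
    (fr : ∀ n, L.Relations n → L'.Relations n) :
    (φ.mapTermRel ft fr fun _ => id).IsQF := by
  induction h with
  | falsum => exact IsQF.falsum
  | of_isAtomic h =>
    cases h with
    | equal t₁ t₂ => exact (IsAtomic.equal _ _).isQF
    | rel R ts => exact (IsAtomic.rel _ _).isQF
  | imp _ _ ih₁ ih₂ => exact ih₁.imp ih₂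

/-- Quantifier-free formulas are preserved by substitution of terms for free variables. [folklore] -/
theorem _root_.FirstOrder.Language.BoundedFormula.IsQF.subst {φ : L.BoundedFormula α n}
    (h : φ.IsQF) (f : α → L.Term β) :
    (φ.subst f).IsQF :=
  h.mapTermRel_id _ _

/-- Quantifier-free formulas are preserved by `restrictFreeVar`. [folklore] -/
theorem _root_.FirstOrder.Language.BoundedFormula.IsQF.restrictFreeVar [DecidableEq α]
    {φ : L.BoundedFormula α n} (h : φ.IsQF)
    (f : φ.freeVarFinset → β) : (φ.restrictFreeVar f).IsQF := by
  induction h with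
  | falsum => exact IsQF.falsum
  | of_isAtomic h =>
    cases h with
    | equal t₁ t₂ => exact (IsAtomic.equal _ _).isQF
    | rel R ts => exact (IsAtomic.rel _ _).isQF
  | imp _ _ ih₁ ih₂ => exact (ih₁ _).imp (ih₂ _)

/-- Quantifier-free formulas are preserved by `toFormula` (turning the bound variables into free
ones). [folklore] -/
theorem _root_.FirstOrder.Language.BoundedFormula.IsQF.toFormula {φ : L.BoundedFormula α n}
    (h : φ.IsQF) : φ.toFormula.IsQF := by
  induction h with
  | falsum => exact IsQF.falsum
  | of_isAtomic h =>
    cases h with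
    | equal t₁ t₂ => exact (IsAtomic.equal _ _).isQF
    | rel R ts => exact (IsAtomic.rel _ _).isQF
  | imp _ _ ih₁ ih₂ => exact ih₁.imp ih₂

/-- Universal formulas are preserved by relabelling of free variables. [folklore] -/
theorem _root_.FirstOrder.Language.BoundedFormula.IsUniversal.relabel {m : ℕ}
    {φ : L.BoundedFormula α m} (h : φ.IsUniversal)
    (g : α → β ⊕ Fin n) : (φ.relabel g).IsUniversal := by
  induction h with
  | of_isQF h => exact (h.relabel g).isUniversal
  | all _ ih =>
    rw [relabel_all]
    exact ih.all

/-- Universal formulas are preserved by `Formula.relabel`. [folklore] -/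
theorem _root_.FirstOrder.Language.BoundedFormula.IsUniversal.formulaRelabel {φ : L.Formula α}
    (h : φ.IsUniversal) (g : α → β) :
    (Formula.relabel g φ).IsUniversal :=
  h.relabel _

/-- The universal closure (over the bound variables) of a universal bounded formula is a universal
formula. [folklore] -/
theorem _root_.FirstOrder.Language.BoundedFormula.IsUniversal.alls :
    ∀ {n : ℕ} {φ : L.BoundedFormula α n}, φ.IsUniversal → φ.alls.IsUniversal
  | 0, _, h => h
  | n + 1, φ, h => FirstOrder.Language.BoundedFormula.IsUniversal.alls (n := n) (φ := φ.all) h.all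

/-- The universal closure of a quantifier-free bounded formula is universal. [folklore] -/
theorem _root_.FirstOrder.Language.BoundedFormula.IsQF.isUniversal_alls {φ : L.BoundedFormula α n}
    (h : φ.IsQF) : φ.alls.IsUniversal :=
  h.isUniversal.alls

end Syntax

/-! ## Maps preserving universal formulas with parameters -/

section Preserve

variable {M : Type w} {N : Type w'} [L.Structure M] [L.Structure N]

variable (L) in
/-- `PreservesUniversal L f` says that the map `f : M → N` preserves every universal formula
with parameters from `M`: whenever `M ⊨ ∀ȳ θ(ā, ȳ)` (`θ` quantifier-free, `ā` from `M`) then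
`N ⊨ ∀ȳ θ(f ā, ȳ)`.  Equivalently `N`, with the constants `ā ↦ f ā`, is a model of the
*universal diagram* of `M` (Avigad 2002, §2: "the universal diagram of `M` is the set of
universal sentences of `L(M)` true in `M`"), or again: `f` is an embedding onto a substructure
that is existentially closed in `N`.  Parameters are represented as variables indexed by `M`,
realized at `id`. [cite: Avigad2002, §2] -/
def PreservesUniversal (f : M → N) : Prop :=
  ∀ ⦃φ : L.Formula M⦄, φ.IsUniversal → φ.Realize (id : M → M) → φ.Realize f

namespace PreservesUniversal

variable {f : M → N}

/-- The identity preserves universal formulas. [folklore] -/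
theorem id : PreservesUniversal L (_root_.id : M → M) := fun _ _ h => h

/-- A map preserving universal formulas preserves quantifier-free formulas with parameters.
[folklore] -/
theorem realize_of_isQF (hf : PreservesUniversal L f) {φ : L.Formula M} (hφ : φ.IsQF)
    (h : φ.Realize (_root_.id : M → M)) : φ.Realize f :=
  hf hφ.isUniversal h

/-- A map preserving universal formulas commutes with the evaluation of terms. [folklore] -/
theorem realize_term (hf : PreservesUniversal L f) {β : Type*} (t : L.Term β) (v : β → M) :
    t.realize (f ∘ v) = f (t.realize v) := by
  have h := hf.realize_of_isQF (φ := Term.equal (t.relabel v) (Term.var (t.realize v)))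
    (IsAtomic.equal _ _).isQF (by simp)
  simpa [Term.realize_relabel] using h

/-- A map preserving universal formulas is injective. [folklore] -/
theorem injective (hf : PreservesUniversal L f) : Function.Injective f := by
  intro a b hab
  by_contra hne
  have h := hf.realize_of_isQF (φ := ∼(Term.equal (Term.var a) (Term.var b)))
    ((IsAtomic.equal _ _).isQF.not) (by simpa using hne)
  exact absurd hab (by simpa using h)

/-- A map preserving universal formulas commutes with the function symbols. [folklore] -/
theorem map_fun (hf : PreservesUniversal L f) {n : ℕ} (F : L.Functions n) (x : Fin n → M) :
    f (Structure.funMap F x) = Structure.funMap F (f ∘ x) := by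
  have h := hf.realize_term (Term.func F Term.var) x
  simp only [Term.realize] at h
  exact h.symm

/-- A map preserving universal formulas preserves and reflects the relation symbols. [folklore] -/
theorem map_rel (hf : PreservesUniversal L f) {n : ℕ} (R : L.Relations n) (x : Fin n → M) :
    Structure.RelMap R (f ∘ x) ↔ Structure.RelMap R x := by
  have e : (fun i => f (x i)) = f ∘ x := rfl
  constructor
  · intro h
    by_contra hx
    have h' := hf.realize_of_isQF (φ := ∼(R.formula fun i => Term.var (x i)))
      ((IsAtomic.rel _ _).isQF.not) (by simpa using hx)
    simp only [Formula.realize_not, Formula.realize_rel, Term.realize_var] at h'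
    exact h' h
  · intro h
    have h' := hf.realize_of_isQF (φ := R.formula fun i => Term.var (x i))
      (IsAtomic.rel _ _).isQF (by simpa using h)
    simp only [Formula.realize_rel, Term.realize_var] at h'
    exact h'

/-- A map preserving universal formulas is an embedding of `L`-structures. [folklore] -/
noncomputable def toEmbedding (hf : PreservesUniversal L f) : M ↪[L] N where
  toFun := f
  inj' := hf.injective
  map_fun' := fun F x => hf.map_fun F x
  map_rel' := fun R x => hf.map_rel R x

/-- `hf.toEmbedding` is `f` pointwise. [folklore] -/
@[simp] theorem toEmbedding_apply (hf : PreservesUniversal L f) (x : M) :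
    hf.toEmbedding x = f x := rfl

/-- `⇑hf.toEmbedding = f`. [folklore] -/
theorem coe_toEmbedding (hf : PreservesUniversal L f) : ⇑hf.toEmbedding = f := rfl

/-- If `f : M → N` preserves universal formulas and `M` is a model of a universal theory `T`,
then so is `N` (Avigad 2002, §3, used in the proof of Thm. 3.2). [cite: Avigad2002, §3] -/
theorem model_of_isUniversal (hf : PreservesUniversal L f) (T : L.Theory) [hT : T.IsUniversal]
    [M ⊨ T] : N ⊨ T := by
  refine ⟨fun φ hφ => ?_⟩
  have hU := hT.isUniversal_of_mem hφ
  have hM : M ⊨ φ := Theory.realize_sentence_of_mem T hφ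
  have h1 : (Formula.relabel (Empty.elim : Empty → M) φ).Realize (_root_.id : M → M) := by
    rw [Formula.realize_relabel]
    have : (_root_.id ∘ Empty.elim : Empty → M) = default := Subsingleton.elim _ _
    rw [this]
    exact hM
  have h2 := hf (hU.formulaRelabel _) h1
  rw [Formula.realize_relabel] at h2
  have : (f ∘ Empty.elim : Empty → N) = default := Subsingleton.elim _ _
  rw [this] at h2
  exact h2

end PreservesUniversal

end Preserve

/-! ## Herbrand saturation -/

section Def

variable (L)

/-- **Herbrand saturation** (Avigad 2002, Definition 3.1).  An `L`-structure `M` is *Herbrand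
saturated* if every principal universal type with parameters from `M` that is consistent with
the universal diagram of `M` is realized in `M`.  Spelled out: for every quantifier-free
`φ(ā, x̄, ȳ)` (`ā` parameters from `M`, represented as variables indexed by `M` and realized at
`id`; `x̄ : Fin k` free; `ȳ : Fin m` bound), if there are a structure `K`, a map `f : M → K`
preserving all universal formulas with parameters (`K` is then a model of the universal diagram
of `M`) and `ē ∈ K` with `K ⊨ ∀ ȳ φ(f ā, ē, ȳ)`, then `M ⊨ ∀ ȳ φ(ā, c̄, ȳ)` for some `c̄ ∈ M`.
The witness structure `K` ranges over the universe `max u v w` of Mathlib's models of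
`L[[M]]`-theories (no restriction, by Löwenheim–Skolem). [cite: Avigad2002, Definition 3.1] -/
def IsHerbrandSaturated (M : Type w) [L.Structure M] : Prop :=
  ∀ ⦃k m : ℕ⦄ (φ : L.BoundedFormula (M ⊕ Fin k) m), φ.IsQF →
    (∃ (K : Type (max u v w)) (_ : L.Structure K) (f : M → K) (e : Fin k → K),
        PreservesUniversal L f ∧ ∀ ys : Fin m → K, φ.Realize (Sum.elim f e) ys) →
    ∃ a : Fin k → M, ∀ bs : Fin m → M, φ.Realize (Sum.elim id a) bs

end Def

/-! ## Satisfiability of a theory plus formulas about named constants -/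

section Sat

variable {α : Type w}

/-- A structure `N` with an assignment `v : α → N` realizing every formula of `S` and modelling
`T` shows that `T` together with the sentences `S` about the constants `α` is satisfiable
(any universe). [folklore] -/
theorem isSatisfiable_union_image_equivSentence_of_realize (T : L.Theory) (S : Set (L.Formula α))
    (N : Type w') [L.Structure N] [Nonempty N] [N ⊨ T] (v : α → N) (hS : ∀ φ ∈ S, φ.Realize v) :
    ((L.lhomWithConstants α).onTheory T ∪ Formula.equivSentence '' S).IsSatisfiable := by
  letI : (constantsOn α).Structure N := constantsOn.structure v
  have h1 : N ⊨ (L.lhomWithConstants α).onTheory T := (LHom.onTheory_model _ T).2 inferInstance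
  have h2 : N ⊨ Formula.equivSentence '' S := ⟨by
    rintro _ ⟨φ, hφ, rfl⟩
    exact (Formula.realize_equivSentence N φ).2 (hS φ hφ)⟩
  have : N ⊨ (L.lhomWithConstants α).onTheory T ∪ Formula.equivSentence '' S :=
    Theory.model_union_iff.2 ⟨h1, h2⟩
  exact Theory.Model.isSatisfiable N

/-- `T` together with the sentences `S` about new constants `α` is satisfiable iff some model of
`T` (in the universe of Mathlib's models of `L[[α]]`-theories) realizes all of `S` under some
assignment of the constants. [folklore] -/
theorem isSatisfiable_union_image_equivSentence_iff (T : L.Theory) (S : Set (L.Formula α)) :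
    ((L.lhomWithConstants α).onTheory T ∪ Formula.equivSentence '' S).IsSatisfiable ↔
      ∃ (N : Type (max u v w)) (_ : L.Structure N) (_ : Nonempty N) (v : α → N),
        N ⊨ T ∧ ∀ φ ∈ S, φ.Realize v := by
  constructor
  · rintro ⟨N⟩
    letI : L.Structure N := (L.lhomWithConstants α).reduct N
    have hT : N ⊨ (L.lhomWithConstants α).onTheory T := N.is_model.mono subset_union_left
    have hS : N ⊨ Formula.equivSentence '' S := N.is_model.mono subset_union_right
    refine ⟨N, inferInstance, inferInstance, fun a => (L.con a : N),
      (LHom.onTheory_model _ T).1 hT, fun φ hφ => ?_⟩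
    exact (Formula.realize_equivSentence N φ).1 (hS.realize_of_mem _ (Set.mem_image_of_mem _ hφ))
  · rintro ⟨N, _, _, v, hT, hS⟩
    exact isSatisfiable_union_image_equivSentence_of_realize T S N v hS

end Sat

/-! ## The construction of Herbrand-saturated models (Avigad 2002, proof of Thm. 3.2) -/

namespace HerbrandConstruction

section Constants

variable (L) (D : Type w)

/-- The data of an `∃∀` sentence `∃ x̄ ∀ ȳ φ(c̄, x̄, ȳ)` over a type `C` of constants: `k = |x̄|`
witness variables, `m = |ȳ|` bound variables and a quantifier-free matrix `φ` whose free variables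
are the constants `C` and the witnesses `Fin k` (Avigad 2002, proof of Thm. 3.2: the formulas
`θᵢ(x̄ᵢ, ȳᵢ)` enumerated there). [cite: Avigad2002, Theorem 3.2] -/
structure ExAll (C : Type w₁) where
  /-- number of witness variables `x̄` -/
  k : ℕ
  /-- number of universally quantified variables `ȳ` -/
  m : ℕ
  /-- the quantifier-free matrix `φ(c̄, x̄, ȳ)` -/
  φ : L.BoundedFormula (C ⊕ Fin k) m
  /-- `φ` is quantifier-free -/
  qf : φ.IsQF

/-- The cumulative tower of constants: stage `0` consists of the seed constants `D`, and stage
`n + 1` adds, for every `∃∀` sentence `σ` over stage `n`, fresh witness constants `c_{σ,i}`,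
`i < σ.k` (Avigad 2002, proof of Thm. 3.2, with all sentences of a stage treated at once).
[cite: Avigad2002, Theorem 3.2] -/
def Cum : ℕ → Type (max u v w)
  | 0 => ULift.{max u v, w} D
  | n + 1 => Cum n ⊕ (Σ σ : ExAll L (Cum n), Fin σ.k)

/-- The witness constants created at stage `n + 1`. [cite: Avigad2002, Theorem 3.2] -/
def New (n : ℕ) : Type (max u v w) :=
  Σ σ : ExAll L (Cum L D n), Fin σ.k

/-- The constants born exactly at stage `n` (seeds at stage `0`). [cite: Avigad2002, Theorem 3.2] -/
def Piece : ℕ → Type (max u v w)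
  | 0 => ULift.{max u v, w} D
  | n + 1 => New L D n

/-- All constants of the limit language `L_ω`, tagged by their stage of birth
(Avigad 2002, proof of Thm. 3.2: the constants `c₀, c₁, …` of `L_ω`).
[cite: Avigad2002, Theorem 3.2] -/
def Cst : Type (max u v w) :=
  Σ n, Piece L D n

variable {L D}

/-- The name (in `L_ω`) of a constant available at stage `n`. [cite: Avigad2002, Theorem 3.2] -/
def name : (n : ℕ) → Cum L D n → Cst L D
  | 0 => fun d => ⟨0, d⟩
  | n + 1 => Sum.elim (name n) (fun x => ⟨n + 1, x⟩)

/-- The fresh witness constant `c_{σ,i}` for the `∃∀` sentence `σ` over stage `n`.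
[cite: Avigad2002, Theorem 3.2] -/
def wit (n : ℕ) (σ : ExAll L (Cum L D n)) (i : Fin σ.k) : Cst L D :=
  ⟨n + 1, ⟨σ, i⟩⟩

/-- The seed constant `d ∈ D` as a constant of `L_ω`. [cite: Avigad2002, Theorem 3.2] -/
def seedC (d : D) : Cst L D :=
  ⟨0, ULift.up d⟩

/-- Names of stage-`n + 1` constants coming from stage `n`. [folklore] -/
@[simp] theorem name_succ_inl (n : ℕ) (c : Cum L D n) :
    name (n + 1) (Sum.inl c : Cum L D (n + 1)) = name n c := rfl

/-- Names of the fresh stage-`n + 1` constants. [folklore] -/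
@[simp] theorem name_succ_inr (n : ℕ) (x : New L D n) :
    name (n + 1) (Sum.inr x : Cum L D (n + 1)) = ⟨n + 1, x⟩ := rfl

/-- A constant available at stage `n` was born at a stage `≤ n`. [folklore] -/
theorem fst_name_le : ∀ (n : ℕ) (c : Cum L D n), (name n c).1 ≤ n
  | 0, _ => le_rfl
  | n + 1, Sum.inl c => (fst_name_le n c).trans (Nat.le_succ n)
  | _ + 1, Sum.inr _ => le_rfl

/-- Every constant born at a stage `≤ n` is available at stage `n`. [folklore] -/
theorem exists_name_eq : ∀ (n : ℕ) (z : Cst L D), z.1 ≤ n → ∃ c : Cum L D n, name n c = z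
  | 0, ⟨j, x⟩, h => by
      obtain rfl : j = 0 := Nat.le_zero.mp h
      exact ⟨x, rfl⟩
  | n + 1, ⟨j, x⟩, h => by
      rcases Nat.lt_or_eq_of_le h with h | rfl
      · obtain ⟨c, hc⟩ := exists_name_eq n ⟨j, x⟩ (Nat.lt_succ_iff.mp h)
        exact ⟨Sum.inl c, hc⟩
      · exact ⟨Sum.inr x, rfl⟩

/-- The stage of a witness constant. [folklore] -/
@[simp] theorem fst_wit (n : ℕ) (σ : ExAll L (Cum L D n)) (i : Fin σ.k) : (wit n σ i).1 = n + 1 :=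
  rfl

/-- Witness constants determine their sentence. [folklore] -/
theorem eq_of_wit_eq_wit {n : ℕ} {σ σ' : ExAll L (Cum L D n)} {i : Fin σ.k} {j : Fin σ'.k}
    (h : wit n σ i = wit n σ' j) : σ = σ' := by
  obtain ⟨-, h2⟩ := Sigma.mk.inj_iff.mp h
  exact (Sigma.mk.inj_iff.mp (eq_of_heq h2)).1

/-- Witness constants of one sentence are pairwise distinct. [folklore] -/
theorem wit_injective (n : ℕ) (σ : ExAll L (Cum L D n)) : Function.Injective (wit n σ) := by
  intro i j h
  obtain ⟨-, h2⟩ := Sigma.mk.inj_iff.mp h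
  obtain ⟨-, h3⟩ := Sigma.mk.inj_iff.mp (eq_of_heq h2)
  exact eq_of_heq h3

/-- A distinguished `∃∀` sentence over stage `0` (`∃ x ⊤`), used to name one constant. [folklore] -/
def σ₀ : ExAll L (Cum L D 0) :=
  ⟨1, 0, ⊤, IsQF.top⟩

/-- A distinguished constant of `L_ω` (so term models are nonempty). [folklore] -/
def c₀ : Cst L D :=
  wit 0 σ₀ ⟨0, Nat.one_pos⟩

/-- `L_ω` has a constant. [folklore] -/
instance : Nonempty (Cst L D) := ⟨c₀⟩

end Constants

section Sentences

variable {D : Type w}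

variable (L D) in
/-- Universal sentences of `L_ω` in the form `∀ ȳ ψ(c̄, ȳ)`: a number `m` of bound variables and a
matrix `ψ` whose free variables are constants of `L_ω` (all matrices arising will be
quantifier-free). [cite: Avigad2002, Theorem 3.2] -/
abbrev USent : Type (max u v w) :=
  Σ m : ℕ, L.BoundedFormula (Cst L D) m

/-- The naming map of the Henkin axiom of `σ`: constants of stage `n` keep their names, the
witness variables `x̄` become the fresh constants `c_{σ,i}`. [cite: Avigad2002, Theorem 3.2] -/
def gmap (n : ℕ) (σ : ExAll L (Cum L D n)) : Cum L D n ⊕ Fin σ.k → Cst L D :=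
  Sum.elim (name n) (wit n σ)

/-- The Henkin-type axiom `∀ ȳ φ_σ(c̄, c̄_σ, ȳ)` attached to the `∃∀` sentence
`σ = ∃ x̄ ∀ ȳ φ_σ(c̄, x̄, ȳ)` over stage `n` (Avigad 2002, proof of Thm. 3.2:
"`Sᵢ ∪ {∀ ȳ θᵢ₊₁(c̄, ȳ)}`"). [cite: Avigad2002, Theorem 3.2] -/
def hen (n : ℕ) (σ : ExAll L (Cum L D n)) : USent L D :=
  ⟨σ.m, σ.φ.subst (Term.var ∘ gmap n σ)⟩

/-- A universal sentence `∀ ȳ ψ(d̄, ȳ)` about the seed constants, as a sentence of `L_ω`.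
[cite: Avigad2002, Theorem 3.4] -/
def seed (τ : Σ m : ℕ, L.BoundedFormula D m) : USent L D :=
  ⟨τ.1, τ.2.subst (Term.var ∘ seedC)⟩

variable {P : Type w'} [L.Structure P]

/-- Semantics of the Henkin axiom of `σ`. [folklore] -/
theorem realize_hen (n : ℕ) (σ : ExAll L (Cum L D n)) (w : Cst L D → P) (ys : Fin σ.m → P) :
    (hen n σ).2.Realize w ys ↔ σ.φ.Realize (Sum.elim (w ∘ name n) (w ∘ wit n σ)) ys := by
  simp only [hen, realize_subst, Function.comp_apply, Term.realize_var]
  refine Iff.of_eq (congrArg (fun v => σ.φ.Realize v ys) (funext fun a => ?_))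
  cases a <;> rfl

/-- The truth value of a Henkin axiom only depends on the constants it names. [folklore] -/
theorem realize_hen_congr (n : ℕ) (σ : ExAll L (Cum L D n)) {w w' : Cst L D → P}
    (h₁ : ∀ c, w (name n c) = w' (name n c)) (h₂ : ∀ i, w (wit n σ i) = w' (wit n σ i))
    (ys : Fin σ.m → P) : (hen n σ).2.Realize w ys ↔ (hen n σ).2.Realize w' ys := by
  rw [realize_hen, realize_hen]
  refine Iff.of_eq (congrArg (fun v => σ.φ.Realize v ys) (funext fun a => ?_))
  cases a with
  | inl c => exact h₁ c
  | inr i => exact h₂ i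

/-- Semantics of a seed sentence. [folklore] -/
theorem realize_seed (τ : Σ m : ℕ, L.BoundedFormula D m) (w : Cst L D → P) (ys : Fin τ.1 → P) :
    (seed τ).2.Realize w ys ↔ τ.2.Realize (w ∘ seedC) ys := by
  simp only [seed, realize_subst, Function.comp_apply, Term.realize_var]
  rfl

/-- Henkin axioms of quantifier-free data are quantifier-free. [folklore] -/
theorem isQF_hen (n : ℕ) (σ : ExAll L (Cum L D n)) : (hen n σ).2.IsQF :=
  σ.qf.subst _

end Sentences

section Theories

variable {D : Type w} (T : L.Theory)

/-- The `L_ω`-theory `T ∪ S`, `S` a set of universal sentences about the constants of `L_ω`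
(as an `L[[Cst]]`-theory of Mathlib). [cite: Avigad2002, Theorem 3.2] -/
def Thy (S : Set (USent L D)) : L[[Cst L D]].Theory :=
  (L.lhomWithConstants (Cst L D)).onTheory T ∪
    (fun τ : USent L D => Formula.equivSentence τ.2.alls) '' S

/-- Consistency (satisfiability) of `T ∪ S`. [cite: Avigad2002, Theorem 3.2] -/
def Sat (S : Set (USent L D)) : Prop :=
  (Thy T S).IsSatisfiable

variable {T}

/-- `Thy` is monotone. [folklore] -/
theorem thy_mono {S S' : Set (USent L D)} (h : S ⊆ S') : Thy T S ⊆ Thy T S' :=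
  union_subset_union_right _ (image_mono h)

/-- `Sat` is antitone. [folklore] -/
theorem Sat.mono {S S' : Set (USent L D)} (h' : Sat T S') (h : S ⊆ S') : Sat T S :=
  Theory.IsSatisfiable.mono h' (thy_mono h)

/-- `Thy T S` as an instance of the generic "theory plus formulas about constants" shape. [folklore] -/
theorem thy_eq (S : Set (USent L D)) : Thy T S =
    (L.lhomWithConstants (Cst L D)).onTheory T ∪
      Formula.equivSentence '' ((fun τ : USent L D => τ.2.alls) '' S) := by
  rw [Thy, image_image]

variable (T) in
/-- A structure realizing `T ∪ S` (any universe) witnesses `Sat T S`. [folklore] -/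
theorem sat_of_realize (S : Set (USent L D)) (N : Type w') [L.Structure N] [Nonempty N] [N ⊨ T]
    (w : Cst L D → N) (hS : ∀ τ ∈ S, ∀ ys : Fin τ.1 → N, τ.2.Realize w ys) : Sat T S := by
  rw [Sat, thy_eq]
  refine isSatisfiable_union_image_equivSentence_of_realize T _ N w ?_
  rintro _ ⟨τ, hτ, rfl⟩
  exact realize_alls.2 (hS τ hτ)

variable (T) in
/-- `Sat T S` holds iff some model of `T` realizes all of `S` under some interpretation of the
constants of `L_ω`. [folklore] -/
theorem sat_iff (S : Set (USent L D)) : Sat T S ↔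
    ∃ (N : Type (max u v w)) (_ : L.Structure N) (_ : Nonempty N) (w : Cst L D → N),
      N ⊨ T ∧ ∀ τ ∈ S, ∀ ys : Fin τ.1 → N, τ.2.Realize w ys := by
  rw [Sat, thy_eq, isSatisfiable_union_image_equivSentence_iff]
  constructor
  · rintro ⟨N, _, _, w, hT, hS⟩
    exact ⟨N, inferInstance, inferInstance, w, hT,
      fun τ hτ => realize_alls.1 (hS _ (mem_image_of_mem _ hτ))⟩
  · rintro ⟨N, _, _, w, hT, hS⟩
    refine ⟨N, inferInstance, inferInstance, w, hT, ?_⟩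
    rintro _ ⟨τ, hτ, rfl⟩
    exact realize_alls.2 (hS τ hτ)

/-- **Zorn step** of the construction: over a consistent `S`, there is a maximal family `Θ` of
`∃∀` sentences of stage `n` whose Henkin axioms can be consistently added
(Avigad 2002, proof of Thm. 3.2, where the sentences are instead treated one at a time along an
enumeration). [cite: Avigad2002, Theorem 3.2] -/
theorem exists_maximal (n : ℕ) (S : Set (USent L D)) (hS : Sat T S) :
    ∃ Θ : Set (ExAll L (Cum L D n)), Sat T (S ∪ hen n '' Θ) ∧
      ∀ σ, σ ∉ Θ → ¬ Sat T (S ∪ hen n '' insert σ Θ) := by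
  set F : Set (Set (ExAll L (Cum L D n))) := {Θ | Sat T (S ∪ hen n '' Θ)} with hF
  have h0 : (∅ : Set (ExAll L (Cum L D n))) ∈ F := by
    simp only [hF, mem_setOf_eq, image_empty, union_empty]
    exact hS
  have hchain : ∀ c ⊆ F, IsChain (· ⊆ ·) c → c.Nonempty → ∃ ub ∈ F, ∀ s ∈ c, s ⊆ ub := by
    intro c hcF hc hne
    refine ⟨⋃₀ c, ?_, fun s hs => subset_sUnion_of_mem hs⟩
    obtain ⟨Θ₀, hΘ₀⟩ := hne
    haveI : Nonempty c := ⟨⟨Θ₀, hΘ₀⟩⟩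
    have hdir : Directed (· ⊆ ·) (fun i : c => Thy T (S ∪ hen n '' (i : Set _))) := by
      have hd : Directed (· ⊆ ·) (fun i : c => (i : Set (ExAll L (Cum L D n)))) :=
        hc.directedOn.directed_val
      exact hd.mono_comp _ (g := fun Θ => Thy T (S ∪ hen n '' Θ))
        (fun a b hab => thy_mono (union_subset_union_right _ (image_mono hab)))
    have hsub : Thy T (S ∪ hen n '' ⋃₀ c) ⊆ ⋃ i : c, Thy T (S ∪ hen n '' (i : Set _)) := by
      intro x hx
      rcases hx with hx | ⟨τ, hτ, rfl⟩
      · exact mem_iUnion.2 ⟨⟨Θ₀, hΘ₀⟩, Or.inl hx⟩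
      · rcases hτ with hτ | ⟨σ, hσ, rfl⟩
        · exact mem_iUnion.2 ⟨⟨Θ₀, hΘ₀⟩, Or.inr ⟨τ, Or.inl hτ, rfl⟩⟩
        · obtain ⟨Θ, hΘc, hσΘ⟩ := mem_sUnion.1 hσ
          exact mem_iUnion.2 ⟨⟨Θ, hΘc⟩, Or.inr ⟨_, Or.inr ⟨σ, hσΘ, rfl⟩, rfl⟩⟩
    have hall : Theory.IsSatisfiable (⋃ i : c, Thy T (S ∪ hen n '' (i : Set _))) :=
      (Theory.isSatisfiable_directed_union_iff hdir).2 fun i => hcF i.2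
    exact hall.mono hsub
  obtain ⟨Θ, -, hΘ⟩ := zorn_subset_nonempty F hchain ∅ h0
  refine ⟨Θ, hΘ.prop, fun σ hσ hsat => hσ ?_⟩
  have : insert σ Θ ⊆ Θ := hΘ.2 hsat (subset_insert _ _)
  exact this (mem_insert σ Θ)

/-! ### The stages -/

variable (S₀ : Set (Σ m : ℕ, L.BoundedFormula D m))

/-- The stages `S₀ ⊆ S₁ ⊆ ⋯` of the construction, each consistent with `T`: `S₀` is the given
set of universal sentences about the seed constants and `Sₙ₊₁` adds the Henkin axioms of a
maximal consistent family of `∃∀` sentences of stage `n` (Avigad 2002, proof of Thm. 3.2).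
[cite: Avigad2002, Theorem 3.2] -/
noncomputable def stage (h₀ : Sat T (seed '' S₀)) : ℕ → {S : Set (USent L D) // Sat T S}
  | 0 => ⟨seed '' S₀, h₀⟩
  | n + 1 =>
    ⟨(stage h₀ n).1 ∪ hen n ''
        Classical.choose (exists_maximal n (stage h₀ n).1 (stage h₀ n).2),
      (Classical.choose_spec (exists_maximal n (stage h₀ n).1 (stage h₀ n).2)).1⟩

variable {S₀} {h₀ : Sat T (seed '' S₀)}

/-- The maximal family of `∃∀` sentences of stage `n` chosen at stage `n + 1`.
[cite: Avigad2002, Theorem 3.2] -/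
noncomputable def Θst (h₀ : Sat T (seed '' S₀)) (n : ℕ) : Set (ExAll L (Cum L D n)) :=
  Classical.choose (exists_maximal n (stage S₀ h₀ n).1 (stage S₀ h₀ n).2)

/-- Stage `0` is the seed. [cite: Avigad2002, Theorem 3.2] -/
theorem stage_zero : (stage S₀ h₀ 0).1 = seed '' S₀ := rfl

/-- Stage `n + 1` adds the Henkin axioms of the chosen maximal family. [cite: Avigad2002, Theorem 3.2] -/
theorem stage_succ (n : ℕ) :
    (stage S₀ h₀ (n + 1)).1 = (stage S₀ h₀ n).1 ∪ hen n '' Θst h₀ n := rfl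

/-- Maximality of the family chosen at stage `n + 1`. [cite: Avigad2002, Theorem 3.2] -/
theorem not_sat_insert {n : ℕ} {σ : ExAll L (Cum L D n)} (hσ : σ ∉ Θst h₀ n) :
    ¬ Sat T ((stage S₀ h₀ n).1 ∪ hen n '' insert σ (Θst h₀ n)) :=
  (Classical.choose_spec (exists_maximal n (stage S₀ h₀ n).1 (stage S₀ h₀ n).2)).2 σ hσ

/-- The stages increase. [cite: Avigad2002, Theorem 3.2] -/
theorem stage_mono : Monotone fun n => (stage S₀ h₀ n).1 :=
  monotone_nat_of_le_succ fun n => by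
    rw [stage_succ]
    exact subset_union_left

variable (S₀ h₀) in
/-- The union `S_ω = ⋃ₙ Sₙ` of the stages. [cite: Avigad2002, Theorem 3.2] -/
def Sω : Set (USent L D) :=
  ⋃ n, (stage S₀ h₀ n).1

/-- Each stage is contained in `S_ω`. [folklore] -/
theorem stage_subset_Sω (n : ℕ) : (stage S₀ h₀ n).1 ⊆ Sω S₀ h₀ :=
  subset_iUnion (fun n => (stage S₀ h₀ n).1) n

/-- The Henkin axioms of the chosen families belong to `S_ω`. [folklore] -/
theorem hen_mem_Sω {n : ℕ} {σ : ExAll L (Cum L D n)} (hσ : σ ∈ Θst h₀ n) :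
    hen n σ ∈ Sω S₀ h₀ :=
  stage_subset_Sω (n + 1) (by rw [stage_succ]; exact Or.inr ⟨σ, hσ, rfl⟩)

/-- The seed sentences belong to `S_ω`. [folklore] -/
theorem seed_mem_Sω {τ : Σ m : ℕ, L.BoundedFormula D m} (hτ : τ ∈ S₀) : seed τ ∈ Sω S₀ h₀ :=
  stage_subset_Sω 0 (mem_image_of_mem _ hτ)

/-- `S_ω` is consistent with `T`, by compactness (Avigad 2002, proof of Thm. 3.2: "each `Sᵢ` is
consistent, and hence so is their union"). [cite: Avigad2002, Theorem 3.2] -/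
theorem sat_Sω : Sat T (Sω S₀ h₀) := by
  have hdir : Directed (· ⊆ ·) (Thy T ∘ fun n => (stage S₀ h₀ n).1) :=
    (stage_mono (S₀ := S₀) (h₀ := h₀)).directed_le.mono_comp _ fun a b hab => thy_mono hab
  have heq : Thy T (Sω S₀ h₀) = ⋃ n, (Thy T ∘ fun n => (stage S₀ h₀ n).1) n := by
    simp only [Thy, Sω, image_iUnion, union_iUnion, Function.comp_apply]
  rw [Sat, heq]
  exact (Theory.isSatisfiable_directed_union_iff hdir).2 fun n => (stage S₀ h₀ n).2

/-- Description of the members of stage `n`. [folklore] -/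
theorem mem_stage_iff {n : ℕ} {τ : USent L D} : τ ∈ (stage S₀ h₀ n).1 ↔
    τ ∈ seed '' S₀ ∨ ∃ i, i < n ∧ ∃ σ ∈ Θst h₀ i, τ = hen i σ := by
  induction n with
  | zero => simp [stage_zero]
  | succ n ih =>
    rw [stage_succ, mem_union, ih]
    constructor
    · rintro ((h | ⟨i, hi, σ, hσ, rfl⟩) | ⟨σ, hσ, rfl⟩)
      · exact Or.inl h
      · exact Or.inr ⟨i, Nat.lt_succ_of_lt hi, σ, hσ, rfl⟩
      · exact Or.inr ⟨n, Nat.lt_succ_self n, σ, hσ, rfl⟩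
    · rintro (h | ⟨i, hi, σ, hσ, rfl⟩)
      · exact Or.inl (Or.inl h)
      · rcases Nat.lt_succ_iff_lt_or_eq.mp hi with hi | rfl
        · exact Or.inl (Or.inr ⟨i, hi, σ, hσ, rfl⟩)
        · exact Or.inr ⟨σ, hσ, rfl⟩

/-- All matrices in the stages are quantifier-free. [folklore] -/
theorem isQF_of_mem_stage (hS₀ : ∀ τ ∈ S₀, τ.2.IsQF) {n : ℕ} {τ : USent L D}
    (hτ : τ ∈ (stage S₀ h₀ n).1) : τ.2.IsQF := by
  rcases mem_stage_iff.mp hτ with ⟨τ₀, hτ₀, rfl⟩ | ⟨i, -, σ, -, rfl⟩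
  · exact (hS₀ τ₀ hτ₀).subst _
  · exact isQF_hen i σ

/-- All matrices in `S_ω` are quantifier-free. [folklore] -/
theorem isQF_of_mem_Sω (hS₀ : ∀ τ ∈ S₀, τ.2.IsQF) {τ : USent L D} (hτ : τ ∈ Sω S₀ h₀) :
    τ.2.IsQF := by
  obtain ⟨n, hn⟩ := mem_iUnion.mp hτ
  exact isQF_of_mem_stage hS₀ hn

/-- The truth value of a stage-`n` sentence only depends on the constants born at stages `≤ n`
(freshness of the later witness constants). [folklore] -/
theorem realize_congr_of_mem_stage {P : Type w'} [L.Structure P] {w w' : Cst L D → P} {n : ℕ}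
    (hw : ∀ z : Cst L D, z.1 ≤ n → w z = w' z) {τ : USent L D} (hτ : τ ∈ (stage S₀ h₀ n).1)
    (ys : Fin τ.1 → P) : τ.2.Realize w ys ↔ τ.2.Realize w' ys := by
  rcases mem_stage_iff.mp hτ with ⟨τ₀, -, rfl⟩ | ⟨i, hi, σ, -, rfl⟩
  · rw [realize_seed, realize_seed]
    have : w ∘ seedC = w' ∘ seedC := funext fun d => hw (seedC d) (Nat.zero_le n)
    rw [this]
  · refine realize_hen_congr i σ (fun c => hw _ ((fst_name_le i c).trans hi.le)) (fun j => hw _ ?_) ys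
    rw [fst_wit]
    exact hi

end Theories

/-! ### The term model and its Herbrand saturation -/

section Model

variable {D : Type w} {T : L.Theory} {S₀ : Set (Σ m : ℕ, L.BoundedFormula D m)}
  {h₀ : Sat T (seed '' S₀)}
variable {N : Type (max u v w')} [L.Structure N] (con : Cst L D → N)

/-- The submodel generated by (the interpretations of) the constants of `L_ω`
(Avigad 2002, proof of Thm. 3.2: "`|M| = {t^N | t ∈ L_ω}`"). [cite: Avigad2002, Theorem 3.2] -/
def Msub : L.Substructure N :=
  Substructure.closure L (range con)

/-- The constants of `L_ω` as elements of the term model. [cite: Avigad2002, Theorem 3.2] -/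
def conM (c : Cst L D) : Msub con :=
  ⟨con c, Substructure.subset_closure (mem_range_self c)⟩

/-- The constants of the term model, seen in `N`. [folklore] -/
@[simp] theorem coe_conM (c : Cst L D) : (conM con c : N) = con c := rfl

/-- The constants of the term model, seen in `N` (function form). [folklore] -/
theorem subtype_comp_conM : (Msub con).subtype ∘ conM con = con := rfl

/-- The term model is nonempty. [folklore] -/
instance : Nonempty (Msub con) := ⟨conM con c₀⟩

/-- Every element of the term model is the value of an `L_ω`-term (Avigad 2002, proof of
Thm. 3.2). [cite: Avigad2002, Theorem 3.2] -/
theorem exists_term_realize_eq (x : Msub con) :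
    ∃ t : L.Term (Cst L D), t.realize (conM con) = x := by
  classical
  obtain ⟨t, ht⟩ := Substructure.mem_closure_iff_exists_term.mp x.2
  choose g hg using fun y : ↥(range con) => mem_range.mp y.2
  refine ⟨t.relabel g, Subtype.ext ?_⟩
  change (Msub con).subtype ((t.relabel g).realize (conM con)) = (x : N)
  rw [← HomClass.realize_term (Msub con).subtype, Term.realize_relabel]
  have h2 : (⇑(Msub con).subtype ∘ conM con) ∘ g = ((↑) : ↥(range con) → N) := funext hg
  rw [h2]
  exact ht

/-- A term denoting the element `x` of the term model. [cite: Avigad2002, Theorem 3.2] -/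
noncomputable def τM (x : Msub con) : L.Term (Cst L D) :=
  Classical.choose (exists_term_realize_eq con x)

/-- `τM con x` denotes `x` in the term model. [folklore] -/
theorem realize_τM (x : Msub con) : (τM con x).realize (conM con) = x :=
  Classical.choose_spec (exists_term_realize_eq con x)

/-- `τM con x` denotes `x` in `N`. [folklore] -/
theorem realize_τM_coe (x : Msub con) : (τM con x).realize con = (x : N) := by
  have h := HomClass.realize_term (Msub con).subtype (t := τM con x) (v := conM con)
  rw [realize_τM] at h
  exact h

/-- **Herbrand saturation of the term model** (Avigad 2002, proof of Thm. 3.2, last paragraph):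
if `N` realizes `T ∪ S_ω` then the submodel of `N` generated by the constants of `L_ω` is
Herbrand saturated. [cite: Avigad2002, Theorem 3.2] -/
theorem isHerbrandSaturated_Msub [T.IsUniversal] (hS₀ : ∀ τ ∈ S₀, τ.2.IsQF) (hNT : N ⊨ T)
    (hcon : ∀ τ ∈ Sω S₀ h₀, ∀ ys : Fin τ.1 → N, τ.2.Realize con ys) :
    IsHerbrandSaturated L (Msub con) := by
  classical
  intro k m φ hφ hex
  obtain ⟨K, _, f, e, hf, hK⟩ := hex
  -- Step A: replace the parameters from `M` by terms of `L_ω`.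
  set φ₂ : L.BoundedFormula (Cst L D ⊕ Fin k) m :=
    φ.subst (Sum.elim (fun x => (τM con x).relabel Sum.inl) (Term.var ∘ Sum.inr)) with hφ₂
  have hφ₂qf : φ₂.IsQF := hφ.subst _
  have key₂ : ∀ {P : Type (max u v w')} [L.Structure P] (w : Cst L D → P) (e' : Fin k → P)
      (ys : Fin m → P),
      φ₂.Realize (Sum.elim w e') ys ↔ φ.Realize (Sum.elim (fun x => (τM con x).realize w) e') ys := by
    intro P _ w e' ys
    rw [hφ₂, realize_subst]
    refine Iff.of_eq (congrArg (fun v => φ.Realize v ys) (funext fun a => ?_))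
    cases a with
    | inl x => simp only [Sum.elim_inl, Term.realize_relabel, Sum.elim_comp_inl]
    | inr i => rfl
  -- Step B: everything happens at some stage `n`.
  let stOf : Cst L D ⊕ Fin k → ℕ := Sum.elim Sigma.fst (fun _ => 0)
  set n : ℕ := φ₂.freeVarFinset.sup stOf with hn
  have hle : ∀ z : Cst L D, Sum.inl z ∈ φ₂.freeVarFinset → z.1 ≤ n :=
    fun z hz => Finset.le_sup (f := stOf) hz
  let ρ : φ₂.freeVarFinset → Cum L D n ⊕ Fin k := fun z =>
    Sum.rec (motive := fun s => s ∈ φ₂.freeVarFinset → Cum L D n ⊕ Fin k)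
      (fun c hc => Sum.inl (Classical.choose (exists_name_eq n c (hle c hc))))
      (fun i _ => Sum.inr i) z.1 z.2
  set φ₃ : L.BoundedFormula (Cum L D n ⊕ Fin k) m := φ₂.restrictFreeVar ρ with hφ₃
  have hφ₃qf : φ₃.IsQF := hφ₂qf.restrictFreeVar ρ
  have key₃ : ∀ {P : Type (max u v w')} [L.Structure P] (w : Cst L D → P) (e' : Fin k → P)
      (ys : Fin m → P),
      φ₃.Realize (Sum.elim (w ∘ name n) e') ys ↔ φ₂.Realize (Sum.elim w e') ys := by
    intro P _ w e' ys
    refine realize_restrictFreeVar (Sum.elim w e') ?_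
    rintro ⟨z | i, hz⟩
    · show Sum.elim (w ∘ name n) e' (Sum.inl (Classical.choose (exists_name_eq n z (hle z hz)))) =
        w z
      simp only [Sum.elim_inl, Function.comp_apply]
      rw [Classical.choose_spec (exists_name_eq n z (hle z hz))]
    · rfl
  let σ : ExAll L (Cum L D n) := ⟨k, m, φ₃, hφ₃qf⟩
  have keyσ : ∀ {P : Type (max u v w')} [L.Structure P] (w : Cst L D → P) (e' : Fin k → P)
      (ys : Fin m → P),
      σ.φ.Realize (Sum.elim (w ∘ name n) e') ys ↔
        φ.Realize (Sum.elim (fun x => (τM con x).realize w) e') ys :=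
    fun w e' ys => (key₃ w e' ys).trans (key₂ w e' ys)
  by_cases hσ : σ ∈ Θst h₀ n
  · -- the Henkin axiom of `σ` was added at stage `n + 1`: its witnesses realize the type
    have hN := hcon _ (hen_mem_Sω hσ)
    refine ⟨fun i => conM con (wit n σ i), fun bs => ?_⟩
    have h1 : σ.φ.Realize (Sum.elim (con ∘ name n) (con ∘ wit n σ)) ((Msub con).subtype ∘ bs) :=
      (realize_hen n σ con _).1 (hN _)
    rw [keyσ] at h1
    have h2 : (Sum.elim (fun x => (τM con x).realize con) (con ∘ wit n σ)) =
        (Msub con).subtype ∘ Sum.elim id (fun i => conM con (wit n σ i)) := by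
      funext a
      cases a with
      | inl x => simp [realize_τM_coe]
      | inr i => rfl
    rw [h2] at h1
    exact (hφ.realize_embedding (Msub con).subtype).1 h1
  · -- otherwise adding it was inconsistent; but `K` provides a model: contradiction
    exfalso
    refine not_sat_insert hσ ?_
    haveI : N ⊨ T := hNT
    haveI : K ⊨ T := hf.model_of_isUniversal T
    haveI : Nonempty K := ⟨f (conM con c₀)⟩
    let w' : Cst L D → K := fun z =>
      if h : ∃ i, wit n σ i = z then e (Classical.choose h) else f (conM con z)
    have hw'wit : ∀ i, w' (wit n σ i) = e i := by
      intro i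
      have h : ∃ j, wit n σ j = wit n σ i := ⟨i, rfl⟩
      show (if h : ∃ j, wit n σ j = wit n σ i then e (Classical.choose h) else f (conM con _)) = e i
      rw [dif_pos h]
      exact congrArg e (wit_injective n σ (Classical.choose_spec h))
    have hw'old : ∀ z : Cst L D, z.1 ≤ n → w' z = f (conM con z) := by
      intro z hz
      have h : ¬ ∃ i, wit n σ i = z := by
        rintro ⟨i, rfl⟩
        rw [fst_wit] at hz
        exact Nat.not_succ_le_self n hz
      show (if h : ∃ j, wit n σ j = z then e (Classical.choose h) else f (conM con z)) = _
      rw [dif_neg h]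
    -- every sentence of `S_ω` transfers from `N` to `M` (substructure) to `K` (along `f`)
    have transfer : ∀ τ ∈ Sω S₀ h₀, ∀ ys : Fin τ.1 → K, τ.2.Realize (f ∘ conM con) ys := by
      intro τ hτ
      have hq : τ.2.IsQF := isQF_of_mem_Sω hS₀ hτ
      have hM : ∀ bs : Fin τ.1 → Msub con, τ.2.Realize (conM con) bs := by
        intro bs
        have h1 : τ.2.Realize ((Msub con).subtype ∘ conM con) ((Msub con).subtype ∘ bs) :=
          hcon τ hτ _
        exact (hq.realize_embedding (Msub con).subtype).1 h1
      have hU : ((τ.2.subst (Term.var ∘ conM con)).alls).IsUniversal := (hq.subst _).isUniversal_alls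
      have h1 : ((τ.2.subst (Term.var ∘ conM con)).alls).Realize (_root_.id : Msub con → Msub con) := by
        simp only [realize_alls, realize_subst, Function.comp_apply, Term.realize_var]
        exact hM
      have h2 := hf hU h1
      simp only [realize_alls, realize_subst, Function.comp_apply, Term.realize_var] at h2
      exact h2
    refine sat_of_realize T _ K w' ?_
    rintro τ (hτ | ⟨σ', hσ', rfl⟩) ys
    · rw [realize_congr_of_mem_stage (w := w') (w' := f ∘ conM con) (fun z hz => hw'old z hz) hτ]
      exact transfer τ (stage_subset_Sω n hτ) ys
    · rcases hσ' with rfl | hσ'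
      · -- the Henkin axiom of `σ` itself holds in `K` with witnesses `e`
        rw [realize_hen]
        have e1 : (Sum.elim (w' ∘ name n) (w' ∘ wit n σ)) = Sum.elim ((f ∘ conM con) ∘ name n) e := by
          funext a
          cases a with
          | inl c => exact hw'old _ (fst_name_le n c)
          | inr i => exact hw'wit i
        rw [e1, keyσ]
        have e3 : (fun x => (τM con x).realize (f ∘ conM con)) = f :=
          funext fun x => by rw [hf.realize_term, realize_τM]
        rw [e3]
        exact hK ys
      · -- Henkin axioms of the other members of the family do not mention the fresh witnesses
        have hne : σ' ≠ σ := fun h => hσ (h ▸ hσ')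
        rw [realize_hen_congr n σ' (w' := f ∘ conM con) (fun c => hw'old _ (fst_name_le n c))
          (fun j => ?_)]
        · exact transfer _ (hen_mem_Sω hσ') ys
        · have h : ¬ ∃ i, wit n σ i = wit n σ' j := fun ⟨i, hi⟩ => hne (eq_of_wit_eq_wit hi).symm
          show (if h : ∃ i, wit n σ i = wit n σ' j then e (Classical.choose h) else f (conM con _)) = _
          rw [dif_neg h]
          rfl

end Model

end HerbrandConstruction


/-! ## Avigad's theorems 3.2, 3.3 and 3.4 -/

section PreservesUniversalIff

variable {M : Type w} {N : Type w'} [L.Structure M] [L.Structure N] {f : M → N}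

/-- A map preserves all universal formulas with parameters iff it preserves all formulas
`∀ ȳ θ(ā, ȳ)` with `θ` quantifier-free (the prenex form used in the construction). [folklore] -/
theorem preservesUniversal_iff :
    PreservesUniversal L f ↔ ∀ ⦃m : ℕ⦄ (θ : L.BoundedFormula M m), θ.IsQF →
      (∀ ys : Fin m → M, θ.Realize (_root_.id : M → M) ys) → ∀ ys : Fin m → N, θ.Realize f ys := by
  constructor
  · intro hf m θ hθ hM
    have h1 : (θ.alls).Realize (_root_.id : M → M) := by
      simp only [realize_alls]
      exact hM
    have h2 := hf hθ.isUniversal_alls h1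
    simp only [realize_alls] at h2
    exact h2
  · intro H φ hφ hM
    suffices key : ∀ {n : ℕ} (ψ : L.BoundedFormula M n), ψ.IsUniversal →
        (∀ xs : Fin n → M, ψ.Realize (_root_.id : M → M) xs) → ∀ xs : Fin n → N, ψ.Realize f xs by
      have := key φ hφ (fun xs => by rwa [Subsingleton.elim xs default]) default
      exact this
    intro n ψ hψ
    induction hψ with
    | of_isQF h => exact H _ h
    | all _ ih =>
      intro h xs
      simp only [realize_all]
      intro a
      refine ih (fun ys => ?_) (Fin.snoc xs a)
      have := h (Fin.init ys)
      simp only [realize_all] at this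
      simpa using this (ys (Fin.last _))

end PreservesUniversalIff

section Theorem32

open HerbrandConstruction

/-- The empty theory is universal. [folklore] -/
instance isUniversal_empty : (∅ : L.Theory).IsUniversal := ⟨fun _ h => h.elim⟩

variable (T : L.Theory) [T.IsUniversal]

/-- Interpretation of the constants of `L_ω` extending a given interpretation of the seeds
(all later constants are sent to a default element). [folklore] -/
def seedVal {D : Type w} {P : Type w'} (v : D → P) (p₀ : P) : Cst L D → P
  | ⟨0, d⟩ => v d.down
  | ⟨_ + 1, _⟩ => p₀

/-- **Avigad 2002, Theorem 3.2** (general form used in the proof of Theorem 3.4): let `T` be a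
universal theory and `S₀` a set of universal sentences `∀ ȳ θ(d̄, ȳ)` (`θ` quantifier-free) about
extra constants `D`, such that `T ∪ S₀` is satisfiable (witnessed by a model `N` of `T` and an
interpretation `v` of `D` realizing `S₀`).  Then `T ∪ S₀` has an Herbrand-saturated model: a
model `K` of `T`, Herbrand saturated as an `L`-structure, with an interpretation `w` of `D`
realizing `S₀`. [cite: Avigad2002, Theorem 3.2] -/
theorem exists_isHerbrandSaturated_of_realize {D : Type w}
    (S₀ : Set (Σ m : ℕ, L.BoundedFormula D m)) (hS₀ : ∀ τ ∈ S₀, τ.2.IsQF)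
    (N : Type w') [L.Structure N] [Nonempty N] [N ⊨ T] (v : D → N)
    (hv : ∀ τ ∈ S₀, ∀ ys : Fin τ.1 → N, τ.2.Realize v ys) :
    ∃ (K : Type (max u v w)) (_ : L.Structure K) (_ : Nonempty K) (w : D → K),
      K ⊨ T ∧ IsHerbrandSaturated L K ∧ ∀ τ ∈ S₀, ∀ ys : Fin τ.1 → K, τ.2.Realize w ys := by
  classical
  obtain ⟨n₀⟩ := ‹Nonempty N›
  have h₀ : Sat T (seed '' S₀ : Set (USent L D)) := by
    refine sat_of_realize T _ N (seedVal v n₀) ?_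
    rintro _ ⟨τ, hτ, rfl⟩ ys
    rw [realize_seed]
    exact hv τ hτ ys
  obtain ⟨N', _, _, con, hN'T, hcon⟩ := (sat_iff T _).1 (sat_Sω (S₀ := S₀) (h₀ := h₀))
  haveI : N' ⊨ T := hN'T
  refine ⟨Msub con, inferInstance, inferInstance, conM con ∘ seedC, inferInstance,
    isHerbrandSaturated_Msub con hS₀ hN'T hcon, fun τ hτ bs => ?_⟩
  have h1 : (seed τ).2.Realize con ((Msub con).subtype ∘ bs) := hcon _ (seed_mem_Sω hτ) _
  rw [realize_seed] at h1
  exact ((hS₀ τ hτ).realize_embedding (Msub con).subtype).1 h1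

/-- **Avigad 2002, Theorem 3.2**: every consistent universal theory has an Herbrand-saturated
model. [cite: Avigad2002, Theorem 3.2] -/
theorem exists_isHerbrandSaturated (hT : T.IsSatisfiable) :
    ∃ (K : Type (max u v)) (_ : L.Structure K) (_ : Nonempty K),
      K ⊨ T ∧ IsHerbrandSaturated L K := by
  obtain ⟨N⟩ := hT
  obtain ⟨K, _, _, -, hKT, hK, -⟩ := exists_isHerbrandSaturated_of_realize T
    (D := PEmpty.{max u v + 1}) ∅ (fun _ h => h.elim) N PEmpty.elim (fun _ h => h.elim)
  exact ⟨K, inferInstance, inferInstance, hKT, hK⟩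

/-- Every structure `M` maps, by a map preserving all universal formulas with parameters (that
is, `Σ₁`-elementarily), into an Herbrand-saturated structure; the target is then a model of
every universal theory `M` models (Avigad 2002, remark after Theorem 3.2: "every model has a
`Σ₁`-elementary extension that is Herbrand saturated"). [cite: Avigad2002, Theorem 3.2] -/
theorem exists_preservesUniversal_isHerbrandSaturated (M : Type w) [L.Structure M] [Nonempty M] :
    ∃ (K : Type (max u v w)) (_ : L.Structure K) (_ : Nonempty K) (f : M → K),
      PreservesUniversal L f ∧ IsHerbrandSaturated L K := by
  let S₀ : Set (Σ m : ℕ, L.BoundedFormula M m) :=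
    {τ | τ.2.IsQF ∧ ∀ ys : Fin τ.1 → M, τ.2.Realize (_root_.id : M → M) ys}
  haveI : M ⊨ (∅ : L.Theory) := ⟨fun _ h => h.elim⟩
  obtain ⟨K, _, _, w, -, hK, hw⟩ := exists_isHerbrandSaturated_of_realize (∅ : L.Theory) S₀
    (fun τ hτ => hτ.1) M _root_.id (fun τ hτ => hτ.2)
  refine ⟨K, inferInstance, inferInstance, w, ?_, hK⟩
  rw [preservesUniversal_iff]
  intro m θ hθ hM
  exact hw ⟨m, θ⟩ ⟨hθ, hM⟩

end Theorem32


section Theorem33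

/-- Every element of the substructure generated by the range of an assignment `v : α → N` is the
value under `v` of a term with variables in `α`. [folklore] -/
theorem exists_term_realize_eq_of_mem_closure {N : Type w'} [L.Structure N] {α : Type w₁}
    (v : α → N) {x : N} (hx : x ∈ Substructure.closure L (range v)) :
    ∃ t : L.Term α, t.realize v = x := by
  classical
  obtain ⟨t, ht⟩ := Substructure.mem_closure_iff_exists_term.mp hx
  choose g hg using fun y : ↥(range v) => mem_range.mp y.2
  refine ⟨t.relabel g, ?_⟩
  rw [Term.realize_relabel]
  have h2 : v ∘ g = ((↑) : ↥(range v) → N) := funext hg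
  rw [h2]
  exact ht

variable {M : Type w} {k m : ℕ}

/-- The instance `φ(ā, x̄, t̄(ā, x̄))` of a matrix `φ(ā, x̄, ȳ)` at a tuple of terms `t̄` for the
bound variables `ȳ` (Avigad 2002, statement of Theorem 3.3). [cite: Avigad2002, Theorem 3.3] -/
def termInstance (φ : L.BoundedFormula (M ⊕ Fin k) m) (tt : Fin m → L.Term (M ⊕ Fin k)) :
    L.Formula (M ⊕ Fin k) :=
  (φ.toFormula).subst (Sum.elim Term.var tt)

/-- Semantics of `termInstance`. [folklore] -/
theorem realize_termInstance {P : Type w'} [L.Structure P] (φ : L.BoundedFormula (M ⊕ Fin k) m)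
    (tt : Fin m → L.Term (M ⊕ Fin k)) (v : M ⊕ Fin k → P) :
    (termInstance φ tt).Realize v ↔ φ.Realize v (fun j => (tt j).realize v) := by
  unfold termInstance
  rw [Formula.Realize, realize_subst, ← Formula.Realize, realize_toFormula]
  rfl

variable [L.Structure M]

/-- **Avigad 2002, Theorem 3.3** (in its "in particular" form): in an Herbrand-saturated
structure `M`, every true `∀∃` statement `∀ x̄ ∃ ȳ φ(ā, x̄, ȳ)` (`φ` quantifier-free, parameters
`ā` from `M`) is witnessed by finitely many tuples of terms `t̄₁, …, t̄ᵣ` in `x̄` and parameters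
from `M`: `M ⊨ ∀ x̄ ⋁ⱼ φ(ā, x̄, t̄ⱼ(x̄))`.  (The proof is Herbrand's theorem, argued
model-theoretically by compactness, applied to the universal diagram of `M`.)
[cite: Avigad2002, Theorem 3.3] -/
theorem IsHerbrandSaturated.exists_finset_term [Nonempty M] (hM : IsHerbrandSaturated L M)
    (φ : L.BoundedFormula (M ⊕ Fin k) m) (hφ : φ.IsQF)
    (h : ∀ xs : Fin k → M, ∃ ys : Fin m → M, φ.Realize (Sum.elim _root_.id xs) ys) :
    ∃ s : Finset (Fin m → L.Term (M ⊕ Fin k)), ∀ xs : Fin k → M, ∃ tt ∈ s,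
      φ.Realize (Sum.elim _root_.id xs) (fun j => (tt j).realize (Sum.elim _root_.id xs)) := by
  classical
  by_contra hcon
  push Not at hcon
  obtain ⟨m₀⟩ := ‹Nonempty M›
  -- the universal diagram of `M` together with all negated term instances of `φ`
  let SU : Set (L.Formula (M ⊕ Fin k)) :=
    (fun ψ : L.Formula M => Formula.relabel Sum.inl ψ) ''
      {ψ | ψ.IsUniversal ∧ ψ.Realize (_root_.id : M → M)}
  let SI : Set (L.Formula (M ⊕ Fin k)) :=
    range fun tt : Fin m → L.Term (M ⊕ Fin k) => ∼(termInstance φ tt)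
  have hsat : ((L.lhomWithConstants (M ⊕ Fin k)).onTheory (∅ : L.Theory) ∪
      Formula.equivSentence '' (SU ∪ SI)).IsSatisfiable := by
    rw [Theory.isSatisfiable_iff_isFinitelySatisfiable]
    intro T0 hT0
    -- the finitely many term tuples mentioned in `T0`
    let ch : L[[M ⊕ Fin k]].Sentence → (Fin m → L.Term (M ⊕ Fin k)) := fun σ =>
      if hσ : ∃ tt, σ = Formula.equivSentence (∼(termInstance φ tt)) then hσ.choose
      else fun _ => Term.var (Sum.inl m₀)
    obtain ⟨xs, hxs⟩ := hcon (T0.image ch)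
    letI : (constantsOn (M ⊕ Fin k)).Structure M := constantsOn.structure (Sum.elim _root_.id xs)
    have hT0M : M ⊨ (T0 : L[[M ⊕ Fin k]].Theory) := by
      refine ⟨fun σ hσ => ?_⟩
      rcases hT0 hσ with hσ' | ⟨ψ', hψ', rfl⟩
      · simp [LHom.onTheory] at hσ'
      rw [Formula.realize_equivSentence]
      change ψ'.Realize (Sum.elim _root_.id xs)
      rcases hψ' with ⟨ψ, ⟨-, hψM⟩, rfl⟩ | ⟨tt, rfl⟩
      · rw [Formula.realize_relabel, Sum.elim_comp_inl]
        exact hψM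
      · have hex : ∃ tt', Formula.equivSentence (∼(termInstance φ tt)) =
            Formula.equivSentence (∼(termInstance φ tt')) := ⟨tt, rfl⟩
        have hch : ch (Formula.equivSentence (∼(termInstance φ tt))) = hex.choose := dif_pos hex
        have heq : ∼(termInstance φ tt) = ∼(termInstance φ hex.choose) :=
          Formula.equivSentence.injective hex.choose_spec
        have hmem : hex.choose ∈ T0.image ch := by
          rw [← hch]
          exact Finset.mem_image_of_mem ch hσ
        show Formula.Realize (∼(termInstance φ tt)) (Sum.elim _root_.id xs)
        rw [heq, Formula.realize_not, realize_termInstance]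
        exact hxs _ hmem
    exact Theory.Model.isSatisfiable M
  obtain ⟨N, _, _, v, -, hv⟩ :=
    (isSatisfiable_union_image_equivSentence_iff (∅ : L.Theory) (SU ∪ SI)).1 hsat
  -- the substructure of `N` generated by `M` and the new constants
  let K : L.Substructure N := Substructure.closure L (range v)
  let v' : M ⊕ Fin k → K := fun a => ⟨v a, Substructure.subset_closure (mem_range_self a)⟩
  have hv' : (K.subtype : K → N) ∘ v' = v := rfl
  have hf' : PreservesUniversal L (v' ∘ Sum.inl) := by
    intro ψ hψ hψM
    have h1 : (Formula.relabel Sum.inl ψ).Realize v := hv _ (Or.inl ⟨ψ, ⟨hψ, hψM⟩, rfl⟩)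
    rw [Formula.realize_relabel] at h1
    have h2 : ψ.Realize ((K.subtype : K → N) ∘ (v' ∘ Sum.inl)) := h1
    have h3 := hψ.realize_embedding K.subtype (v := v' ∘ Sum.inl) (xs := (default : Fin 0 → K))
    rw [Subsingleton.elim ((K.subtype : K → N) ∘ (default : Fin 0 → K)) default] at h3
    exact h3 h2
  have hK : ∀ ys : Fin m → K, (∼φ).Realize (Sum.elim (v' ∘ Sum.inl) (v' ∘ Sum.inr)) ys := by
    intro ys hys
    choose tt htt using fun j => exists_term_realize_eq_of_mem_closure v (ys j).2
    have e1 : Sum.elim (v' ∘ Sum.inl) (v' ∘ Sum.inr) = v' := by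
      funext a; cases a <;> rfl
    rw [e1] at hys
    have h1 : φ.Realize ((K.subtype : K → N) ∘ v') ((K.subtype : K → N) ∘ ys) :=
      (hφ.realize_embedding K.subtype).2 hys
    have e2 : (K.subtype : K → N) ∘ ys = fun j => (tt j).realize v := funext fun j => (htt j).symm
    rw [hv', e2, ← realize_termInstance] at h1
    exact (hv _ (Or.inr ⟨tt, rfl⟩)) h1
  obtain ⟨a, ha⟩ := hM (∼φ) hφ.not ⟨K, inferInstance, v' ∘ Sum.inl, v' ∘ Sum.inr, hf', hK⟩
  obtain ⟨ys, hys⟩ := h a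
  exact ha ys hys

end Theorem33

section Theorem34

/-- **Avigad 2002, Theorem 3.4** (the recipe for `∀∃`-conservation theorems): let `T₂` be a
universal theory and `T₁` a theory in the same language.  If every Herbrand-saturated model of
`T₂` is a model of `T₁`, then every `∀∃` sentence (here: `∃ ȳ φ(x̄, ȳ)` with `φ` quantifier-free
and free variables `x̄`, read universally closed, as Mathlib's `⊨ᵇ` does) provable in `T₁` is
provable in `T₂`.  Provability is semantic consequence `⊨ᵇ`; the Herbrand-saturated models range
over the universe of Mathlib's models of `L[[α]]`-theories. [cite: Avigad2002, Theorem 3.4] -/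
theorem modelsBoundedFormula_exs_of_isHerbrandSaturated (T₁ T₂ : L.Theory) [T₂.IsUniversal]
    {α : Type w} {m : ℕ} (φ : L.BoundedFormula α m) (hφ : φ.IsQF)
    (H : ∀ (K : Type (max u v w)) [L.Structure K] [Nonempty K],
      K ⊨ T₂ → IsHerbrandSaturated L K → K ⊨ T₁)
    (h : T₁ ⊨ᵇ φ.exs) : T₂ ⊨ᵇ φ.exs := by
  intro M v xs
  obtain rfl : xs = default := Subsingleton.elim _ _
  by_contra hc
  have hc' : ∀ ys : Fin m → M, ¬ φ.Realize v ys := fun ys hys => hc (realize_exs.2 ⟨ys, hys⟩)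
  obtain ⟨K, _, _, w, hKT, hK, hw⟩ := exists_isHerbrandSaturated_of_realize T₂
    ({⟨m, ∼φ⟩} : Set (Σ m : ℕ, L.BoundedFormula α m)) (by
      rintro τ rfl
      exact hφ.not) M v (by
      rintro τ rfl ys
      exact hc' ys)
  haveI : K ⊨ T₁ := H K hKT hK
  obtain ⟨ys, hys⟩ := realize_exs.1 (h (Theory.ModelType.of T₁ K) w default)
  exact hw ⟨m, ∼φ⟩ rfl ys hys

end Theorem34

end Literature.ModelTheory.UniversalTheories
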